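import Summits.HubbardSuperconductivity.HubbardSuperconductivity.Theorems.AnisotropyChordTransferFibre3B1WLoop

/-!
# Route `AnisotropyChord` / H0 rotor rung, LEVEL 2 family B1: the WEIGHTED-UPPER bracket of the two-gradient
three-propagator loop — the summed theorem and its ν-cell form (row D Stage 2, `SSS` N-family)

Continuation of `…Fibre3B1WLoop` (objects `wloopSum`, `hiSumW`, `tailG` and the pointwise domination `wloop_pointwise`).
  ★★ `wloop_upper`:  for `θ = 2π/L ≤ θ₀`, `θ₀K ≤ π/2`, `|s_i|∞ ≤ S`, `2 + 2S ≤ K`, `e₁, e₂ ∈ E4`, `0 ≤ ν < 4/π²`,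
  `θ⁴ · wloopSum L (νθ²) s₀ s₁ s₂ e₁ e₂ ≤ hiSumW ν θ₀ K S s₀ s₁ s₂ e₁ e₂ + c_Z(ν) · tailConst ν (K − 2S) 2`
  (summed exactly as `B1.b1_upper`: the window majorant reindexed by the injective `rep`, the three shifted one-propagator
  squared tails reindexed by `Equiv.addRight` and bounded by `tail_majorant_sum_le` with `n = 2`);
  ★★ `wloop_upper_cell`: for `0 ≤ ν ≤ ν₂ < 4/π²` the right-hand side at `ν₂` bounds the left-hand side at `ν`
  (`hiSumW_mono`, `cZ_mono`, `tailConst_mono`) — ONE endpoint evaluation certifies a whole ν-cell for every `L` with `2π/L ≤ θ₀`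
  (the kernel evaluator of the sibling `…Fibre3B1WEval` turns it into one `decide`).
Prover seat `hubbard-h0-rotor-p2` g7; helper for piece A = stmt-HubbardSuperconductivity-23918 of rung 19089
(`--supports`, helper class).  Nothing here proves superconductivity in the Hubbard model; helper lemmas of ONE conditional
reduction (the GM₃ ∀L certificate, Level-2 row D); the rotor TARGET as originally worded stays FALSE (g15 verdict).
Mathlib + the tree only; no sorry.
-/

set_option linter.dupNamespace false
set_option autoImplicit false

noncomputable section

open scoped BigOperators

namespace Summit.HubbardSuperconductivity.HubbardSuperconductivity.Theorems.AnisotropyChord.Transfer.Fibre3.B1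

open L2.N1

variable (L : ℕ) [NeZero L]

/-! ## The bracket -/

/-- ★★ **THE WEIGHTED-UPPER B1 BRACKET of the two-gradient three-propagator loop** (row D Stage 2):
for `θ = 2π/L ≤ θ₀`, `θ₀K ≤ π/2`, `|s_i|∞ ≤ S`, `2 + 2S ≤ K`, `e₁, e₂ ∈ E4`, `0 ≤ ν < 4/π²`:
`θ⁴ · wloopSum L (νθ²) s₀ s₁ s₂ e₁ e₂ ≤ hiSumW ν θ₀ K S s₀ s₁ s₂ e₁ e₂ + c_Z(ν) · tailConst ν (K − 2S) 2` — L-independent. -/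
theorem wloop_upper (θ0 : ℝ) (K S : ℕ) (s₀ s₁ s₂ e₁ e₂ : ℤ × ℤ) (he₁ : e₁ ∈ E4) (he₂ : e₂ ∈ E4)
    (hS : ∀ i, (sh3 s₀ s₁ s₂ i).1.natAbs ≤ S ∧ (sh3 s₀ s₁ s₂ i).2.natAbs ≤ S) (hK : 2 + 2 * S ≤ K)
    (hθ0 : 2 * Real.pi / L ≤ θ0) (hθ0K : θ0 * K ≤ Real.pi / 2)
    (ν : ℝ) (hν0 : 0 ≤ ν) (hν : ν < 4 / Real.pi ^ 2) :
    ((2 * Real.pi / L) ^ 2) ^ 2 * wloopSum L (ν * (2 * Real.pi / L) ^ 2) s₀ s₁ s₂ e₁ e₂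
      ≤ hiSumW ν θ0 K S s₀ s₁ s₂ e₁ e₂ + RowD.cZ ν * tailConst ν (K - 2 * S) 2 := by
  classical
  have h4K := four_mul_le_of_scales L θ0 K hθ0 hθ0K
  have hK'2 : 2 ≤ K - 2 * S := by omega
  have hK'N : K - 2 * S ≤ L / 2 := by omega
  have hcZ : 0 ≤ RowD.cZ ν := (RowD.cZ_pos hν).le
  unfold wloopSum
  rw [Finset.mul_sum]
  set Aw : ℤ × ℤ → ℝ := fun p =>
    if p ∈ idx K S (sh3 s₀ s₁ s₂) then wWeight s₁ s₂ e₁ e₂ p * ∏ i, (1 / (winE θ0 (p + sh3 s₀ s₁ s₂ i) - ν)) else 0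
    with hAw
  have hdom : ∀ k : Tor L,
      ((2 * Real.pi / L) ^ 2) ^ 2 *
        (gres L (ν * (2 * Real.pi / L) ^ 2) (k + toTor L s₀)
          * (RowD.wnorm L (k + toTor L s₁) (toTor L e₁) * gres L (ν * (2 * Real.pi / L) ^ 2) (k + toTor L s₁))
          * (RowD.wnorm L (k + toTor L s₂) (toTor L e₂) * gres L (ν * (2 * Real.pi / L) ^ 2) (k + toTor L s₂)))
      ≤ Aw (rep L k) + RowD.cZ ν * ((1 / 2) * tailG L ν (K - 2 * S) (k + toTor L s₀)
          + (1 / 4) * tailG L ν (K - 2 * S) (k + toTor L s₁) + (1 / 4) * tailG L ν (K - 2 * S) (k + toTor L s₂)) := by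
    intro k
    have h := wloop_pointwise L θ0 K S s₀ s₁ s₂ e₁ e₂ he₁ he₂ hS hK hθ0 hθ0K ν hν0 hν k
    rw [hAw]
    exact h
  -- the window majorant sums to at most `hiSumW`
  have hrep_inj : Function.Injective (rep L) := rep_injective L
  have hsumA : ∑ k : Tor L, Aw (rep L k) ≤ hiSumW ν θ0 K S s₀ s₁ s₂ e₁ e₂ := by
    unfold hiSumW
    rw [← Finset.sum_image (fun x _ y _ h => hrep_inj h)]
    rw [hAw, ← Finset.sum_filter]
    apply Finset.sum_le_sum_of_subset_of_nonneg
    · intro p hp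
      exact (Finset.mem_filter.mp hp).2
    · intro p hp _
      rw [mem_idx_iff] at hp
      exact mul_nonneg (wWeight_nonneg _ _ _ _ _) (Finset.prod_nonneg fun i _ =>
        div_nonneg zero_le_one (hi_den_pos L ν hν θ0 K hθ0 hθ0K _ (hp.2 i)).le)
  -- the tail majorant: reindex each shift, then the one-propagator bound
  have hre : ∀ t : ℤ × ℤ, ∑ k : Tor L, tailG L ν (K - 2 * S) (k + toTor L t) = ∑ k : Tor L, tailG L ν (K - 2 * S) k :=
    fun t => Equiv.sum_comp (Equiv.addRight (toTor L t)) (tailG L ν (K - 2 * S))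
  have hsumG : ∑ k : Tor L, tailG L ν (K - 2 * S) k ≤ tailConst ν (K - 2 * S) 2 := by
    unfold tailG
    exact tail_majorant_sum_le L ν hν0 hν (K - 2 * S) 2 hK'2 hK'N le_rfl
  calc ∑ k : Tor L, ((2 * Real.pi / L) ^ 2) ^ 2 *
        (gres L (ν * (2 * Real.pi / L) ^ 2) (k + toTor L s₀)
          * (RowD.wnorm L (k + toTor L s₁) (toTor L e₁) * gres L (ν * (2 * Real.pi / L) ^ 2) (k + toTor L s₁))
          * (RowD.wnorm L (k + toTor L s₂) (toTor L e₂) * gres L (ν * (2 * Real.pi / L) ^ 2) (k + toTor L s₂)))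
      ≤ ∑ k : Tor L, (Aw (rep L k) + RowD.cZ ν * ((1 / 2) * tailG L ν (K - 2 * S) (k + toTor L s₀)
          + (1 / 4) * tailG L ν (K - 2 * S) (k + toTor L s₁) + (1 / 4) * tailG L ν (K - 2 * S) (k + toTor L s₂))) :=
        Finset.sum_le_sum fun k _ => hdom k
    _ = ∑ k : Tor L, Aw (rep L k) + RowD.cZ ν * ((1 / 2) * ∑ k : Tor L, tailG L ν (K - 2 * S) (k + toTor L s₀)
          + (1 / 4) * ∑ k : Tor L, tailG L ν (K - 2 * S) (k + toTor L s₁)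
          + (1 / 4) * ∑ k : Tor L, tailG L ν (K - 2 * S) (k + toTor L s₂)) := by
        rw [Finset.sum_add_distrib, ← Finset.mul_sum, Finset.sum_add_distrib, Finset.sum_add_distrib,
          ← Finset.mul_sum, ← Finset.mul_sum, ← Finset.mul_sum]
    _ = ∑ k : Tor L, Aw (rep L k) + RowD.cZ ν * ∑ k : Tor L, tailG L ν (K - 2 * S) k := by
        rw [hre s₀, hre s₁, hre s₂]; ring
    _ ≤ hiSumW ν θ0 K S s₀ s₁ s₂ e₁ e₂ + RowD.cZ ν * tailConst ν (K - 2 * S) 2 :=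
        add_le_add hsumA (mul_le_mul_of_nonneg_left hsumG hcZ)

/-- ★★ **THE WEIGHTED-UPPER BRACKET ON A ν-CELL**: for `0 ≤ ν ≤ ν₂ < 4/π²` (and the hypotheses of `wloop_upper`),
`θ⁴ · wloopSum L (νθ²) … ≤ hiSumW ν₂ θ₀ K S … + c_Z(ν₂) · tailConst ν₂ (K − 2S) 2` — ONE endpoint evaluation certifies the cell,
for every `L` with `2π/L ≤ θ₀`. -/
theorem wloop_upper_cell (θ0 : ℝ) (K S : ℕ) (s₀ s₁ s₂ e₁ e₂ : ℤ × ℤ) (he₁ : e₁ ∈ E4) (he₂ : e₂ ∈ E4)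
    (hS : ∀ i, (sh3 s₀ s₁ s₂ i).1.natAbs ≤ S ∧ (sh3 s₀ s₁ s₂ i).2.natAbs ≤ S) (hK : 2 + 2 * S ≤ K)
    (hθ0 : 2 * Real.pi / L ≤ θ0) (hθ0K : θ0 * K ≤ Real.pi / 2)
    (ν ν₂ : ℝ) (hν0 : 0 ≤ ν) (hνν₂ : ν ≤ ν₂) (hν₂ : ν₂ < 4 / Real.pi ^ 2) :
    ((2 * Real.pi / L) ^ 2) ^ 2 * wloopSum L (ν * (2 * Real.pi / L) ^ 2) s₀ s₁ s₂ e₁ e₂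
      ≤ hiSumW ν₂ θ0 K S s₀ s₁ s₂ e₁ e₂ + RowD.cZ ν₂ * tailConst ν₂ (K - 2 * S) 2 := by
  have hν : ν < 4 / Real.pi ^ 2 := lt_of_le_of_lt hνν₂ hν₂
  have h4K := four_mul_le_of_scales L θ0 K hθ0 hθ0K
  have h := wloop_upper L θ0 K S s₀ s₁ s₂ e₁ e₂ he₁ he₂ hS hK hθ0 hθ0K ν hν0 hν
  refine h.trans (add_le_add (hiSumW_mono L ν ν₂ hνν₂ hν₂ θ0 K S hθ0 hθ0K s₀ s₁ s₂ e₁ e₂) ?_)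
  have hK'2 : 2 ≤ K - 2 * S := by omega
  have hK'R : (2 : ℝ) ≤ ((K - 2 * S : ℕ) : ℝ) := by exact_mod_cast hK'2
  have hpi3 := Real.pi_gt_three
  have hc1 : ν * Real.pi ^ 2 / 4 < 1 := by
    rw [div_lt_one (by norm_num)]
    have := (lt_div_iff₀ (by positivity)).mp hν
    linarith
  have hT0 : 0 ≤ tailConst ν (K - 2 * S) 2 := by
    unfold tailConst
    have hD1 : 0 < (((K - 2 * S : ℕ) : ℝ) + 1) ^ 2 - ν * Real.pi ^ 2 / 4 := by nlinarith
    have hD2 : 0 < ((K - 2 * S : ℕ) : ℝ) ^ 2 - ν * Real.pi ^ 2 / 4 := by nlinarith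
    positivity
  exact mul_le_mul (cZ_mono ν ν₂ hνν₂ hν₂) (tailConst_mono ν ν₂ hν0 hνν₂ hν₂ (K - 2 * S) 2 hK'2) hT0
    (RowD.cZ_pos hν₂).le

end Summit.HubbardSuperconductivity.HubbardSuperconductivity.Theorems.AnisotropyChord.Transfer.Fibre3.B1

end
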